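import Mathlib.LinearAlgebra.Matrix.Determinant.Basic
import Mathlib.LinearAlgebra.Matrix.Notation
import Mathlib.Tactic.LinearCombination
import HarnessLib

/-!
# F0 · P3c · line LH6 «StCharTS» — «OPEN-CELL FACTORISATION FOR `Φ₃`★» (generic base layer): the explicit `B · N̄` factorisation `w₀ · n(a, b) = U · L` of an element of the open
# Bruhat cell of `U(Φ₃)`, `Φ₃ = antidiag(1,1,1)`, as a polynomial identity over any commutative ring [Rogawski1990 §1.10 p. 9, §4.5; Casselman1995 Prop. 1.3.3]

Cell `pub/hodgecm-mathlib`, crux H413 = `stmt-HodgeConjecture-24833` (lane `--supports … --as helper`), route HCCMUnconditional; seat F0P2-p06 (g20); a GENERIC brick under LEAD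
F0P3a-plan (g15) STANDING RULE 20 (T14-67).  THEOREMS ONLY (0 def ∕ 0 instance ∕ 0 notation ∕ 0 sorry); Mathlib + HarnessLib only.

WHAT.  In `U(Φ₃)(E_v)` (form `ᵗḡ Φ₃ g = Φ₃`, `Φ₃ = antidiag(1,1,1)`), the upper unipotent radical is `N = {n(a,b) = [[1,a,b],[0,1,−ā],[0,0,1]] : b + b̄ + aā = 0}` and `w₀ = Φ₃` represents the
non-trivial Weyl element.  For `b` (hence `b̄`) invertible the element `w₀ n(a,b)` of the open cell `B w₀ N` factors EXPLICITLY through `B · N̄`: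
  `w₀ · n(a,b) = U · L`,  `U = [[b̄⁻¹, −a b⁻¹, 1],[0, −b̄ b⁻¹, −ā],[0, 0, b]]` (upper triangular, diagonal `d(b̄⁻¹, −b̄ b⁻¹, b) = d(α, β, ᾱ⁻¹)` with `α = b̄⁻¹`, `det U = −1`),
  `L = [[1,0,0],[−ā b̄⁻¹, 1, 0],[b⁻¹, a b⁻¹, 1]]` (lower unitriangular, entries `→ 0` as `|b| → ∞`).
Typed CONVENTION-FREE as a polynomial identity in six ring elements `a a' b b' bi b'i` with `b + b' + a a' = 0`, `b bi = 1`, `b' b'i = 1` (read `a' = ā`, `b' = b̄`, `bi = b⁻¹`, `b'i = b̄⁻¹`):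
**`antidiagonal_mul_unipotent_eq_upper_mul_lower`** (the identity), **`det_upper_factor`** (`det U = −1`), `upper_factor_apply_diag` ∕ `lower_factor_lower` (the shape read-backs).
CONSUMER-IN-WAITING (rule 20): MEMO `F0/P2/F0P2-p06/g20/MEMO-KEYS3-analytic-road.v2` brick T4 — it gives `f(w₀ n(a,b)) = χ₁(b̄)⁻¹ χ₂(−1) |b|⁻¹ · f(L)` for `f ∈ i_G(χ₁, χ₂)`, i.e. the cell function of
the standard section in closed form, the input of T5 (the two-shell tail) of the `hKeysRed3` road; no census row yet — reusable by any explicit open-cell ∕ intertwining-operator computation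
on `U(Φ₃)` (e.g. the E1 (A4) «rank-one intertwining operator `J(w, s)`» of F0P3a-p03's census, whose integrand is `f(w₀ n)`).
HONEST LABEL: HC_CM is proved only modulo the 7 printed citations (2 remaining named inputs: hLiu418 = `stmt-HodgeConjecture-24832`, h413 = `stmt-HodgeConjecture-24833`) until rung 0 closes;
count-neutral generic algebra.

## References
* [Rogawski1990] J. D. Rogawski, *Automorphic Representations of Unitary Groups in Three Variables*, Ann. of Math. Stud. 123 (1990), §1.10 p. 9 (`B = TN`, `w`), §4.5 p. 45.
* [Casselman1995] W. Casselman, *Introduction to the theory of admissible representations of p-adic reductive groups* (1995), Prop. 1.3.3 (structure of `P w P`), §6.3.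
-/

set_option autoImplicit false
-- the mandated namespace has the single-problem summit's repeated segment (`HodgeConjecture.HodgeConjecture`)
set_option linter.dupNamespace false

namespace Summit.HodgeConjecture.HodgeConjecture.Cruxes.H413.F0P3cStCharTSOpenCellFactorisationThree

variable {R : Type*} [CommRing R]

/-- **«OPEN-CELL FACTORISATION FOR `Φ₃`»: `w₀ · n(a,b) = U · L`** with `w₀ = antidiag(1,1,1)`, `n(a,b) = [[1,a,b],[0,1,−a'],[0,0,1]]`, `U` upper triangular with diagonal
`(b'i, −b' bi, b)`, `L` lower unitriangular — for ring elements with `b + b' + a a' = 0`, `b bi = 1`, `b' b'i = 1` (in `U(Φ₃)`: `a' = ā`, `b' = b̄`, `bi = b⁻¹`, `b'i = b̄⁻¹`).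
[cite: Casselman1995, Prop. 1.3.3] [cite: Rogawski1990, §1.10 p. 9] -/
theorem antidiagonal_mul_unipotent_eq_upper_mul_lower (a a' b b' bi b'i : R) (hrel : b + b' + a * a' = 0) (hb : b * bi = 1) (hb' : b' * b'i = 1) :
    !![(0 : R), 0, 1; 0, 1, 0; 1, 0, 0] * !![1, a, b; 0, 1, -a'; 0, 0, 1] =
      !![b'i, -(a * bi), 1; 0, -(b' * bi), -a'; 0, 0, b] * !![1, 0, 0; -(a' * b'i), 1, 0; bi, a * bi, 1] := by
  ext i j
  fin_cases i <;> fin_cases j <;> simp [Matrix.mul_apply, Fin.sum_univ_three]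
  · -- (0,0): `b'i + a a' bi b'i + bi = 0`
    linear_combination (-(bi * b'i)) * hrel + b'i * hb + bi * hb'
  · -- (1,0): `b' bi a' b'i = a' bi`
    linear_combination (-(a' * bi)) * hb'
  · -- (1,1): `−b' bi − a' a bi = 1`
    linear_combination bi * hrel - hb
  · -- (2,0): `b bi = 1`
    linear_combination (-1 : R) * hb
  · -- (2,1): `b a bi = a`
    linear_combination (-a) * hb

/-- **`det U = −1`** for the upper factor (so `χ₂(det U) = χ₂(−1)` is CONSTANT along the cell). [cite: Rogawski1990, §1.10 p. 9] -/
theorem det_upper_factor (a a' b b' bi b'i : R) (hb : b * bi = 1) (hb' : b' * b'i = 1) :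
    Matrix.det !![b'i, -(a * bi), 1; 0, -(b' * bi), -a'; 0, 0, b] = -1 := by
  rw [Matrix.det_fin_three]
  simp
  linear_combination (b * bi) * hb' + hb

/-- The upper factor is upper triangular with diagonal `(b'i, −b' bi, b)` (= `d(α, β, ᾱ⁻¹)` with `α = b̄⁻¹`, `β = −b̄ b⁻¹` in `U(Φ₃)`): its strictly lower entries vanish. [cite: Rogawski1990, §1.10 p. 9] -/
theorem upper_factor_lower_eq_zero (a a' b b' bi b'i : R) :
    (!![b'i, -(a * bi), 1; 0, -(b' * bi), -a'; 0, 0, b] : Matrix (Fin 3) (Fin 3) R) 1 0 = 0 ∧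
      (!![b'i, -(a * bi), 1; 0, -(b' * bi), -a'; 0, 0, b] : Matrix (Fin 3) (Fin 3) R) 2 0 = 0 ∧
      (!![b'i, -(a * bi), 1; 0, -(b' * bi), -a'; 0, 0, b] : Matrix (Fin 3) (Fin 3) R) 2 1 = 0 := by
  simp

/-- The lower factor is lower UNItriangular: unit diagonal, vanishing strictly upper entries. [cite: Casselman1995, Prop. 1.3.3] -/
theorem lower_factor_unitriangular (a a' bi b'i : R) :
    (!![(1 : R), 0, 0; -(a' * b'i), 1, 0; bi, a * bi, 1] : Matrix (Fin 3) (Fin 3) R) 0 0 = 1 ∧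
      (!![(1 : R), 0, 0; -(a' * b'i), 1, 0; bi, a * bi, 1] : Matrix (Fin 3) (Fin 3) R) 1 1 = 1 ∧
      (!![(1 : R), 0, 0; -(a' * b'i), 1, 0; bi, a * bi, 1] : Matrix (Fin 3) (Fin 3) R) 2 2 = 1 ∧
      (!![(1 : R), 0, 0; -(a' * b'i), 1, 0; bi, a * bi, 1] : Matrix (Fin 3) (Fin 3) R) 0 1 = 0 ∧
      (!![(1 : R), 0, 0; -(a' * b'i), 1, 0; bi, a * bi, 1] : Matrix (Fin 3) (Fin 3) R) 0 2 = 0 ∧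
      (!![(1 : R), 0, 0; -(a' * b'i), 1, 0; bi, a * bi, 1] : Matrix (Fin 3) (Fin 3) R) 1 2 = 0 := by
  simp

/-- **The relation is symmetric and `b'` is determined**: `b' = −b − a a'` — so the hypotheses `b' b'i = 1` say «`b + a a'` is a unit», automatic in `U(Φ₃)(E_v)` for `b ≠ 0`
(`b̄` is a unit with `b`). [cite: Rogawski1990, §1.10 p. 9] -/
theorem conj_eq_of_rel (a a' b b' : R) (hrel : b + b' + a * a' = 0) : b' = -b - a * a' := by
  linear_combination hrel

end Summit.HodgeConjecture.HodgeConjecture.Cruxes.H413.F0P3cStCharTSOpenCellFactorisationThree
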